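import Summits.QuantumFields.BalabanUV.Beta.GAN24.DressedHalfVertex
import Summits.QuantumFields.BalabanUV.Beta.GAN24.DressedMultiplierVertexZero
import Summits.QuantumFields.BalabanUV.Beta.GAN24.WilsonFaceHalfVertex
import Summits.QuantumFields.BalabanUV.Beta.GAN24.WilsonEdgeCurrentDiag
import Summits.QuantumFields.BalabanUV.Beta.SpineRecursiveW

/-!
# `BalabanUV.Beta.GAN24.RespGaugeStencil` — binder row G-an2-4 ∕ (CONV-C), W-slot CT-W, conservation law (C)∕(C)sym, step (L3c)(iii) of this lineage's note
# `HOME/b2b-balaban-gan24-formalise-leaf-04/g66/CSYM-LEVEL0-KERNEL-BLUEPRINT.md` §8: **THE BACKGROUND DERIVATIVE `dM X̃♮_j Lc S M μ c` SUMMED OVER ITS BOND `c`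
# IS THE GAUGE STENCIL `𝒮_μ = Lc·s_m s_f·σ_j · Σ'_t 𝟙f(t_μ)·S μ t`** (the bordered operator differentiated along the pure-gauge exit-face field of direction `μ`), a
# block-covariant decaying kernel; **AND ITS SOURCE CURRENT ON FIELD LEGS IS ANTISYMMETRIC IN `(μ, ν)` AT LEVEL 0**: for `S♮_0 = unitS s_f s_m (cE•wilsonA + cVH•vhSAt)`,
# `Σ'_{s′} 𝟙f(s′_ν)·Σ'_{t′} 𝟙f(t′_μ)·S♮_0 μ t′ s s′ (inl b)(inl ν) + (μ ↔ ν) = 0` for every `s b` (the edge current of `WilsonEdgeCurrent` read with opposite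
# orientations; the diagonal `μ = ν` by `WilsonEdgeCurrentDiag`; `vhSAt` has no field–field block)

NOT IN PRINT; OUR BOOKKEEPING ([folklore] over TREE objects BY NAME: this lineage's `DressedHalfVertex.hasSum_vertexOfK_dressedStep` (the field half of the bond sum reads the
exit face), `DressedMultiplierVertexZero.hasSum_vertexOfM_dressedStep` ((S2c): the multiplier half of the bond sum vanishes), `WilsonFaceHalfVertex.hasSum_biweighted_wilsonA ∕
hasSum_pair_wilsonA_right`, `WilsonEdgeCurrent.sum_box1_biweighted_wilsonA_at`, `WilsonEdgeCurrentDiag.sum_box1_biweighted_wilsonA_diag_at`, an2's `StepJetData.wilsonA_antisymm`;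
G-an2-4 formalisation swarm, leaf prover `b2b-balaban-gan24-formalise-leaf-04`, gen 67).  HONEST FRAMING (cell contract, verbatim): «discharging `BetaPertH` makes Bałaban's UV
stability UNCONDITIONAL — a real constructive-QFT result; it is NOT the continuum limit and NOT the Clay problem.»  HONEST DEPENDENCY (verbatim): «continuum YM on T⁴ ⇐
BetaPertH ∧ nine spine estimates (0/9 proved); BetaPertH ⇐ (D1) ∧ (D4) ∧ CAP+tail; G-an2-4 gates asym, D1 and NE2/3/4.»

WHY (blueprint §8 (L3c), this gen's mechanism note): the last two numbers of `DressedSourceZeroModeLevelZero.zmode_dressedSource_level0_inl_inl` are the outer-summed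
second-response words `Σ_{c∈box}Σ'_{u′} FF[dM (K2OfK X̃♮_0 Lc S♮_0 M μ c) Lc S♮_0 M ν u′]` and their `(μ ↔ ν)` partner.  By joint block covariance the lattice sum can be moved
onto the INNER bond: `Σ'_{c′} K2OfK X̃ Lc S M μ c′ = −X̃ ∘ (Σ'_{c′} dM X̃ Lc S M μ c′) ∘ X̃ = −X̃ ∘ 𝒮_μ ∘ X̃`, and the column charges of that kernel against `inr ν` are
`−X̃·(𝒮_μ h^{(ν)})` with `h^{(ν)}` the exit-face field (`DressedStepFaceCharges.hasSum_dressedStep_col`).  The vector `𝒮_μ h^{(ν)}` is, on field legs, the biweighted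
contraction of the cubic Wilson table with the face profile on the slot's `μ`-coordinate and on the second leg's `ν`-coordinate — the EDGE CURRENT — and
`𝒮_μ h^{(ν)} + 𝒮_ν h^{(μ)} = 0` there (§3); the `(μ,ν)`-symmetrised response word therefore only sees multiplier-leg sources, which are block constants (§4) and die on the
zero `mm` charge ∕ on the cell telescoping of the two-leg face current (successor files).

WHAT ([folklore]; generic `d`; 0 `def`, 0 cited facts, 0 `def … : Prop`, 0 sorry):
§1 **`hasSum_dM_dressedStep_bond`** (in-block root, `1 ≤ Lc`, every `j`, all units, `S` `LocStencil` ∕ `M` `VertexFamily` at positive rates, pointwise in the legs):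
`HasSum (c ↦ dM X̃♮_j Lc S M μ c x z a b) (Lc·s_m s_f·σ_j · Σ'_t [t_μ % Lc = Lc − 1]·S μ t x z a b)`.
§2 GENERIC: `decays_tsum_of_biLoc_family` (a `t`-indexed family bi-localised at `t` with one constant sums to a DECAYING kernel, rate `δ/2`, constant `C·Zl(δ/2)`),
**`decays_faceStencil`** (`𝒮_μ ∕ (Lc s_m s_f σ_j)` decays), **`shiftK_faceStencil`** (block covariance `shiftK (−Lc•v) 𝒮 = 𝒮` for a block-covariant `S`),
`summable_faceStencil_slot`.
§3 LEVEL 0, field legs: `hasSum_pair_faceface_wilsonA` (`μ ≠ ν`: the pair sum over (slot, second leg) with one-coordinate weights `p ∕ q`, first leg `(s, inl b)` free, is MINUS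
the edge current), `hasSum_pair_faceface_wilsonA_diag` (`μ = ν`: zero), **`tsum_pair_faceface_wilsonA_add_swap`** (the `(μ,p) ↔ (ν,q)` symmetrised pair sum is `0`, all `μ ν`),
`SpureRecAt_zero_unitS_inl_inl` (the ff entries of `S♮_0` are `(s_f s_m)⁻¹ s_f⁻² cE ·` the Wilson table), **`tsum_faceface_S0_add_swap`** (the nested `ite` form used downstream:
`Σ'_{s′} [s′_ν]·Σ'_{t′} [t′_μ]·S♮_0 μ t′ s s′ (inl b)(inl ν) + (μ ↔ ν) = 0`).
§4 `tsum_faceface_block_periodic` (the nested face source `Σ'_{s′}[s′_ν]·Σ'_{t′}[t′_μ]·S μ t′ s s′ f g` is `N`-block-periodic in `s` for a block-covariant `S`, all legs `f g`).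
Asserts NO value of Bałaban's tables beyond an3's DEFINED stencil identities quoted; discharges NOTHING of (C)sym ∕ (Q-D) ∕ (Q-D-rate) ∕ «T2Shape» ∕ «T2Drift» ∕ (hW, hWall); NEVER
«G-an2-4 closed» as (CONV-C); NOT D1, NOT `BetaPertH`, NOT continuum, NOT Clay.  2026-08-23; no existing file touched.
-/

noncomputable section

open Finset
open scoped BigOperators
open Literature.MathematicalPhysics.QuantumFieldTheory
open Literature.MathematicalPhysics.QuantumFieldTheory.Balaban1983to89
open Literature.MathematicalPhysics.QuantumFieldTheory.Balaban1983to89.Beta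
open AffineAveraging (Site box toSite)
open B12Sec2to5 (l1 l1_nonneg)
open ExpKernelCalculus (MKer Decays BiLoc VertexFamily Zl Zl_nonneg shiftK summable_exp_shift tsum_exp_shift l1_sub_triangle)
open OneStepResolventKernel (Fib LocStencil)
open OneStepKernelFamily (KInvStep vertexOfK)
open StepJetData (wilsonA wilsonA_antisymm)
open BalabanStepJets (box1)
open SecondOrderResponse (dM vertexOfM dM_apply)
open Summit.QuantumFields.BalabanUV.Beta.HessKerDressedUnits (unitK unitS unitS_apply legScale_inl)
open Summit.QuantumFields.BalabanUV.Beta.AxialDressingRooted (coDressKBmAt)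
open Summit.QuantumFields.BalabanUV.Beta.SpineRooted (SpureRecAt SpureRecAt_zero_level)
open Summit.QuantumFields.BalabanUV.Beta.GAN24.DressedHalfVertex (hasSum_vertexOfK_dressedStep)
open Summit.QuantumFields.BalabanUV.Beta.GAN24.DressedMultiplierVertexZero (hasSum_vertexOfM_dressedStep)
open Summit.QuantumFields.BalabanUV.Beta.GAN24.WilsonFaceHalfVertex (hasSum_biweighted_wilsonA hasSum_pair_wilsonA_right)
open Summit.QuantumFields.BalabanUV.Beta.GAN24.WilsonEdgeCurrentDiag (sum_box1_biweighted_wilsonA_diag_at)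

namespace Summit.QuantumFields.BalabanUV.Beta.GAN24.RespGaugeStencil

variable {d : ℕ}

/-! ## §1 The bond sum of the background derivative through the dressed step kernel is the gauge stencil -/

section BondSum

variable {Lc : ℕ} [NeZero Lc] {r : Fin (d + 1) → ℕ} {S M : Fin (d + 1) → Site (d + 1) → MKer (d + 1) (Fib d)} {Cs δs CM δM : ℝ}

/-- [folklore] **THE BOND SUM OF `dM X̃♮_j Lc S M μ c` IS THE GAUGE STENCIL** (pointwise in the legs): the field half reads the `μ`-exit face
(`DressedHalfVertex.hasSum_vertexOfK_dressedStep`), the multiplier half vanishes ((S2c), `DressedMultiplierVertexZero.hasSum_vertexOfM_dressedStep`):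
`HasSum (c ↦ dM X̃♮_j Lc S M μ c x z a b) (Lc·s_m s_f·σ_j · Σ'_t [t_μ % Lc = Lc − 1]·S μ t x z a b)`. -/
theorem hasSum_dM_dressedStep_bond (hLc : 1 ≤ Lc) (hr : r ∈ box (d + 1) Lc) (sf sm : ℝ) (j : ℕ)
    (hS : LocStencil S Cs δs) (hδs : 0 < δs) (hM : VertexFamily M Lc CM δM) (hδM : 0 < δM)
    (μ : Fin (d + 1)) (x z : Site (d + 1)) (a b : Fib d) :
    HasSum (fun c : Site (d + 1) => dM (unitK sf sm (coDressKBmAt (toSite r) Lc (KInvStep (d := d) Lc j))) Lc S M μ c x z a b)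
      (((Lc : ℝ) * (sm * sf)) * ((((Lc ^ (j + 1) : ℕ) : ℝ)) ^ (d + 1 + 1))⁻¹ *
        ∑' t : Site (d + 1), (if t μ % (Lc : ℤ) = (Lc : ℤ) - 1 then S μ t x z a b else 0)) := by
  have h1 := hasSum_vertexOfK_dressedStep (d := d) hLc hr sf sm j μ hS hδs x z a b
  have h2 := hasSum_vertexOfM_dressedStep (d := d) hLc hr sf sm j hM hδM μ x z a b
  have h := h1.add h2
  rw [add_zero] at h
  refine h.congr_fun fun c => ?_
  rw [dM_apply]

end BondSum

/-! ## §2 Generic: a family bi-localised at its own index sums to a decaying kernel; the face stencil decays and is block-covariant -/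

section Generic

variable {D : ℕ} {F : Type*}

/-- [folklore] **A `t`-INDEXED FAMILY BI-LOCALISED AT `t` WITH ONE CONSTANT SUMS TO A DECAYING KERNEL**: `|T t x z a b| ≤ C·e^{−δ(|x−t|+|z−t|)}` (`δ > 0`) ⟹
`Decays (Σ'_t T t) (C·Zl(δ/2)) (δ/2)` — `δ(|x−t|+|z−t|) ≥ (δ/2)|x−z| + (δ/2)|x−t|`, then the shifted exponential sum. -/
theorem decays_tsum_of_biLoc_family {T : Site D → MKer D F} {C δ : ℝ} (hT : ∀ t, BiLoc (T t) t t C δ) (hδ : 0 < δ) (hC : 0 ≤ C) :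
    Decays (fun x z a b => ∑' t : Site D, T t x z a b) (C * Zl D (δ / 2)) (δ / 2) := by
  intro x z a b
  have hle : ∀ t : Site D, |T t x z a b| ≤ (C * Real.exp (-(δ / 2) * l1 (x - z))) * Real.exp (-(δ / 2) * l1 (x - t)) := by
    intro t
    refine (hT t x z a b).trans ?_
    rw [mul_assoc, ← Real.exp_add]
    refine mul_le_mul_of_nonneg_left (Real.exp_le_exp.2 ?_) hC
    have h3 := l1_sub_triangle x t z
    rw [ExpKernelCalculus.l1_sub_symm t z] at h3
    nlinarith [l1_nonneg (x - t), l1_nonneg (z - t), hδ.le]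
  have hs := (summable_exp_shift (half_pos hδ) x).mul_left (C * Real.exp (-(δ / 2) * l1 (x - z)))
  have hb := tsum_of_norm_bounded hs.hasSum (fun t => by rw [Real.norm_eq_abs]; exact hle t)
  rw [Real.norm_eq_abs] at hb
  refine hb.trans (le_of_eq ?_)
  rw [tsum_mul_left, tsum_exp_shift]
  ring

variable {d : ℕ} {N : ℕ}

/-- [folklore] **THE FACE STENCIL `Σ'_t [t_μ % N = N − 1]·S μ t` OF A LOCAL STENCIL FAMILY DECAYS** (rate `δ/2`, constant `Cs·Zl(δ/2)`). -/
theorem decays_faceStencil {S : Fin (d + 1) → Site (d + 1) → MKer (d + 1) (Fib d)} {Cs δ : ℝ} (hS : LocStencil S Cs δ) (hδ : 0 < δ)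
    (μ : Fin (d + 1)) :
    Decays (fun x z a b => ∑' t : Site (d + 1), (if t μ % (N : ℤ) = (N : ℤ) - 1 then S μ t x z a b else 0)) (Cs * Zl (d + 1) (δ / 2)) (δ / 2) := by
  have hCs : 0 ≤ Cs := (hS 0 0).nonneg (Sum.inl 0)
  refine decays_tsum_of_biLoc_family (T := fun t => fun x z a b => if t μ % (N : ℤ) = (N : ℤ) - 1 then S μ t x z a b else 0)
    (fun t x z a b => ?_) hδ hCs
  show |(if t μ % (N : ℤ) = (N : ℤ) - 1 then S μ t x z a b else 0)| ≤ _
  split_ifs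
  · exact hS μ t x z a b
  · rw [abs_zero]; exact (abs_nonneg _).trans (hS μ t x z a b)

/-- [folklore] The slot series of the face stencil is summable at every entry. -/
theorem summable_faceStencil_slot {S : Fin (d + 1) → Site (d + 1) → MKer (d + 1) (Fib d)} {Cs δ : ℝ} (hS : LocStencil S Cs δ) (hδ : 0 < δ)
    (μ : Fin (d + 1)) (x z : Site (d + 1)) (a b : Fib d) :
    Summable fun t : Site (d + 1) => (if t μ % (N : ℤ) = (N : ℤ) - 1 then S μ t x z a b else 0) := by
  have hCs : 0 ≤ Cs := (hS 0 0).nonneg (Sum.inl 0)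
  refine Summable.of_norm_bounded ((summable_exp_shift hδ x).mul_left Cs) (fun t => ?_)
  rw [Real.norm_eq_abs]
  have h1 : |S μ t x z a b| ≤ Cs * Real.exp (-δ * l1 (x - t)) := by
    refine (hS μ t x z a b).trans (mul_le_mul_of_nonneg_left (Real.exp_le_exp.2 ?_) hCs)
    nlinarith [l1_nonneg (z - t), l1_nonneg (x - t), hδ.le]
  split_ifs
  · exact h1
  · rw [abs_zero]; exact (abs_nonneg _).trans h1

/-- [folklore] **THE FACE STENCIL OF A BLOCK-COVARIANT FAMILY IS BLOCK-COVARIANT**: `S μ (t + N•v) = shiftK (−N•v) (S μ t)` for all `t v` ⟹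
`shiftK (−N•v) 𝒮 = 𝒮` for `𝒮 = Σ'_t [t_μ % N = N − 1]·S μ t` (reindex the slot by `t ↦ t + N•v`; the face indicator is `N`-periodic). -/
theorem shiftK_faceStencil {S : Fin (d + 1) → Site (d + 1) → MKer (d + 1) (Fib d)}
    (hScov : ∀ (κ : Fin (d + 1)) (u t : Site (d + 1)), S κ (u + (N : ℤ) • t) = shiftK (-((N : ℤ) • t)) (S κ u)) (μ : Fin (d + 1)) (v : Site (d + 1)) :
    shiftK (-((N : ℤ) • v)) (fun x z a b => ∑' t : Site (d + 1), (if t μ % (N : ℤ) = (N : ℤ) - 1 then S μ t x z a b else 0)) =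
      fun x z a b => ∑' t : Site (d + 1), (if t μ % (N : ℤ) = (N : ℤ) - 1 then S μ t x z a b else 0) := by
  funext x z a b
  simp only [shiftK]
  rw [← (Equiv.addRight ((N : ℤ) • v)).tsum_eq (fun t : Site (d + 1) => if t μ % (N : ℤ) = (N : ℤ) - 1 then S μ t x z a b else 0)]
  refine tsum_congr fun t => ?_
  simp only [Equiv.coe_addRight]
  have e1 : (t + (N : ℤ) • v) μ % (N : ℤ) = t μ % (N : ℤ) := by
    simp only [Pi.add_apply, Pi.smul_apply, smul_eq_mul, Int.add_mul_emod_self_left]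
  have e2 : S μ (t + (N : ℤ) • v) x z a b = S μ t (x + -((N : ℤ) • v)) (z + -((N : ℤ) • v)) a b := by
    rw [hScov μ t v]
    rfl
  rw [e1, e2]

end Generic

/-! ## §3 Level 0, field legs: the (slot, second-leg)-biweighted Wilson table is minus the edge current; its `(μ ↔ ν)` symmetrisation vanishes -/

section Wilson

/-- [folklore] **WEIGHTS ON (SLOT, SECOND LEG), FIRST LEG FREE, `μ ≠ ν`: MINUS THE EDGE CURRENT** (`WilsonFaceHalfVertex.hasSum_biweighted_wilsonA` through
`wilsonA_antisymm`): `Σ'_{(t,w)} p(t_μ)·q(w_ν)·wilsonA d μ t s w (inl b) (inl ν) = −([b = μ]·p(s_μ)(q(s_ν − 1) − q(s_ν)) + [b = ν]·q(s_ν)(p(s_μ) − p(s_μ − 1)))`. -/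
theorem hasSum_pair_faceface_wilsonA {μ ν : Fin (d + 1)} (hμν : μ ≠ ν) (p q : ℤ → ℝ) (b : Fin (d + 1)) (s : Site (d + 1)) :
    HasSum (fun tw : Site (d + 1) × Site (d + 1) => p (tw.1 μ) * q (tw.2 ν) * wilsonA d μ tw.1 s tw.2 (Sum.inl b) (Sum.inl ν))
      (-((if b = μ then p (s μ) * (q (s ν - 1) - q (s ν)) else 0) + (if b = ν then q (s ν) * (p (s μ) - p (s μ - 1)) else 0))) := by
  have h := (hasSum_biweighted_wilsonA (d := d) hμν p q b s).neg
  refine h.congr_fun fun tw => ?_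
  show p (tw.1 μ) * q (tw.2 ν) * wilsonA d μ tw.1 s tw.2 (Sum.inl b) (Sum.inl ν) = -(p (tw.1 μ) * q (tw.2 ν) * wilsonA d μ tw.1 tw.2 s (Sum.inl ν) (Sum.inl b))
  rw [wilsonA_antisymm μ tw.1 tw.2 s (Sum.inl ν) (Sum.inl b)]
  ring

/-- [folklore] **THE SAME-AXIS CASE `μ = ν` VANISHES** (`WilsonEdgeCurrentDiag.sum_box1_biweighted_wilsonA_diag_at` in the pair-`HasSum` currency, legs exchanged by
`wilsonA_antisymm`): `Σ'_{(t,w)} p(t_μ)·q(w_μ)·wilsonA d μ t s w (inl b) (inl μ) = 0`. -/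
theorem hasSum_pair_faceface_wilsonA_diag (μ : Fin (d + 1)) (p q : ℤ → ℝ) (b : Fin (d + 1)) (s : Site (d + 1)) :
    HasSum (fun tw : Site (d + 1) × Site (d + 1) => p (tw.1 μ) * q (tw.2 μ) * wilsonA d μ tw.1 s tw.2 (Sum.inl b) (Sum.inl μ)) 0 := by
  have h0 := hasSum_pair_wilsonA_right (d := d) μ (fun t w => p (t μ) * q (w μ)) s μ b
  rw [sum_box1_biweighted_wilsonA_diag_at μ p q b s] at h0
  have h := h0.neg
  rw [neg_zero] at h
  refine h.congr_fun fun tw => ?_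
  show p (tw.1 μ) * q (tw.2 μ) * wilsonA d μ tw.1 s tw.2 (Sum.inl b) (Sum.inl μ) = -(p (tw.1 μ) * q (tw.2 μ) * wilsonA d μ tw.1 tw.2 s (Sum.inl μ) (Sum.inl b))
  rw [wilsonA_antisymm μ tw.1 tw.2 s (Sum.inl μ) (Sum.inl b)]
  ring

/-- [folklore] **THE `(μ,p) ↔ (ν,q)`-SYMMETRISED PAIR SUM VANISHES** (every `μ ν`, all `p q`, every free leg `(s, b)`):
`Σ'_{(t,w)} p(t_μ)q(w_ν)·wilsonA d μ t s w (inl b)(inl ν) + Σ'_{(t,w)} q(t_ν)p(w_μ)·wilsonA d ν t s w (inl b)(inl μ) = 0` — the two edge currents are the boundary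
circulation of the same plaquette column read with opposite orientations (`WilsonEdgeCurrent.sum_box1_biweighted_wilsonA_at_add_swap`); the diagonal by §`_diag`. -/
theorem tsum_pair_faceface_wilsonA_add_swap (μ ν : Fin (d + 1)) (p q : ℤ → ℝ) (b : Fin (d + 1)) (s : Site (d + 1)) :
    (∑' tw : Site (d + 1) × Site (d + 1), p (tw.1 μ) * q (tw.2 ν) * wilsonA d μ tw.1 s tw.2 (Sum.inl b) (Sum.inl ν)) +
      ∑' tw : Site (d + 1) × Site (d + 1), q (tw.1 ν) * p (tw.2 μ) * wilsonA d ν tw.1 s tw.2 (Sum.inl b) (Sum.inl μ) = 0 := by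
  by_cases hμν : μ = ν
  · subst hμν
    rw [(hasSum_pair_faceface_wilsonA_diag μ p q b s).tsum_eq, (hasSum_pair_faceface_wilsonA_diag μ q p b s).tsum_eq, add_zero]
  · rw [(hasSum_pair_faceface_wilsonA hμν p q b s).tsum_eq, (hasSum_pair_faceface_wilsonA (Ne.symm hμν) q p b s).tsum_eq]
    have hbb : ¬(b = μ ∧ b = ν) := fun hh => hμν (hh.1.symm.trans hh.2)
    by_cases hbμ : b = μ
    · have hbν : b ≠ ν := fun h' => hbb ⟨hbμ, h'⟩
      simp only [hbμ, if_true, if_neg hμν]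
      ring
    · by_cases hbν : b = ν
      · simp only [hbν, if_true, if_neg (Ne.symm hμν)]
        ring
      · simp only [hbμ, hbν, if_false]
        ring

end Wilson

/-! ## §3b The nested `ite` form at the level-0 tables `S♮_0 = unitS s_f s_m (cE•wilsonA + cVH•vhSAt)` -/

section LevelZero

variable {Lc : ℕ} [NeZero Lc]

/-- [folklore] **THE FIELD–FIELD ENTRIES OF `S♮_0`**: `unitS s_f s_m (SpureRecAt … 0) κ u x z (inl a) (inl b) = (s_f s_m)⁻¹·s_f⁻¹·s_f⁻¹·cE · wilsonA d κ u x z (inl a) (inl b)`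
(`vhSAt` has no field–field block — `rfl`). -/
theorem SpureRecAt_zero_unitS_inl_inl (ρ : Fin (d + 1) → ℤ) (sf sm cE cVH cΛ : ℝ) (κ : Fin (d + 1)) (u x z : Site (d + 1)) (a b : Fin (d + 1)) :
    unitS sf sm (SpureRecAt d Lc ρ cE cVH cΛ 0) κ u x z (Sum.inl a) (Sum.inl b) =
      ((sf * sm)⁻¹ * (sf⁻¹ * sf⁻¹) * cE) * wilsonA d κ u x z (Sum.inl a) (Sum.inl b) := by
  rw [unitS_apply, SpureRecAt_zero_level]
  have h0 : AveragingHessianKernelsRooted.vhSAt ρ d Lc rfl κ u x z (Sum.inl a) (Sum.inl b) = 0 := rfl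
  simp only [Pi.add_apply, Pi.smul_apply, smul_eq_mul, h0, mul_zero, add_zero, legScale_inl]
  ring

/-- [folklore] The pair family `(t, w) ↦ p(t_μ)·q(w_ν)·wilsonA d μ t s w (inl b) (inl ν)` is summable (finite support). -/
theorem summable_pair_faceface_wilsonA (μ ν : Fin (d + 1)) (p q : ℤ → ℝ) (b : Fin (d + 1)) (s : Site (d + 1)) :
    Summable fun tw : Site (d + 1) × Site (d + 1) => p (tw.1 μ) * q (tw.2 ν) * wilsonA d μ tw.1 s tw.2 (Sum.inl b) (Sum.inl ν) := by
  by_cases hμν : μ = ν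
  · subst hμν
    exact (hasSum_pair_faceface_wilsonA_diag μ p q b s).summable
  · exact (hasSum_pair_faceface_wilsonA hμν p q b s).summable

/-- [folklore] **THE NESTED `ite` PAIR SUM IS THE PAIR `tsum`** (indicator weights; the inner slot sum first):
`Σ'_w [w_ν % N = N−1]·(Σ'_t [t_μ % N = N−1]·wilsonA d μ t s w (inl b)(inl ν)) = Σ'_{(t,w)} 𝟙(t_μ)𝟙(w_ν)·wilsonA d μ t s w (inl b)(inl ν)`. -/
theorem tsum_ite_ite_wilsonA_eq_pair (N : ℕ) (μ ν : Fin (d + 1)) (b : Fin (d + 1)) (s : Site (d + 1)) :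
    (∑' w : Site (d + 1), (if w ν % (N : ℤ) = (N : ℤ) - 1 then
        ∑' t : Site (d + 1), (if t μ % (N : ℤ) = (N : ℤ) - 1 then wilsonA d μ t s w (Sum.inl b) (Sum.inl ν) else 0) else 0)) =
      ∑' tw : Site (d + 1) × Site (d + 1), (if tw.1 μ % (N : ℤ) = (N : ℤ) - 1 then (1 : ℝ) else 0) * (if tw.2 ν % (N : ℤ) = (N : ℤ) - 1 then (1 : ℝ) else 0) *
        wilsonA d μ tw.1 s tw.2 (Sum.inl b) (Sum.inl ν) := by
  have hs := summable_pair_faceface_wilsonA (d := d) μ ν (fun n => if n % (N : ℤ) = (N : ℤ) - 1 then (1 : ℝ) else 0)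
    (fun n => if n % (N : ℤ) = (N : ℤ) - 1 then (1 : ℝ) else 0) b s
  have hs' : Summable fun q : Site (d + 1) × Site (d + 1) =>
      (if q.2 μ % (N : ℤ) = (N : ℤ) - 1 then (1 : ℝ) else 0) * (if q.1 ν % (N : ℤ) = (N : ℤ) - 1 then (1 : ℝ) else 0) *
        wilsonA d μ q.2 s q.1 (Sum.inl b) (Sum.inl ν) := hs.prod_symm
  calc (∑' w : Site (d + 1), (if w ν % (N : ℤ) = (N : ℤ) - 1 then
        ∑' t : Site (d + 1), (if t μ % (N : ℤ) = (N : ℤ) - 1 then wilsonA d μ t s w (Sum.inl b) (Sum.inl ν) else 0) else 0))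
      = ∑' w : Site (d + 1), ∑' t : Site (d + 1), (if t μ % (N : ℤ) = (N : ℤ) - 1 then (1 : ℝ) else 0) * (if w ν % (N : ℤ) = (N : ℤ) - 1 then (1 : ℝ) else 0) *
          wilsonA d μ t s w (Sum.inl b) (Sum.inl ν) := by
        refine tsum_congr fun w => ?_
        split_ifs with hw
        · refine tsum_congr fun t => ?_
          split_ifs <;> ring
        · symm
          refine (tsum_congr fun t => ?_).trans tsum_zero
          ring
    _ = ∑' q : Site (d + 1) × Site (d + 1), (if q.2 μ % (N : ℤ) = (N : ℤ) - 1 then (1 : ℝ) else 0) * (if q.1 ν % (N : ℤ) = (N : ℤ) - 1 then (1 : ℝ) else 0) *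
          wilsonA d μ q.2 s q.1 (Sum.inl b) (Sum.inl ν) := hs'.tsum_prod.symm
    _ = _ := (Equiv.prodComm (Site (d + 1)) (Site (d + 1))).tsum_eq
          (fun tw : Site (d + 1) × Site (d + 1) => (if tw.1 μ % (N : ℤ) = (N : ℤ) - 1 then (1 : ℝ) else 0) * (if tw.2 ν % (N : ℤ) = (N : ℤ) - 1 then (1 : ℝ) else 0) *
            wilsonA d μ tw.1 s tw.2 (Sum.inl b) (Sum.inl ν))

/-- [folklore] **THE `(μ ↔ ν)`-SYMMETRISED FACE–FACE SOURCE OF `S♮_0` VANISHES ON FIELD LEGS** (every `μ ν`, in-block root irrelevant, all units and colour constants,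
every free leg `(s, inl b)`): `Σ'_{s′} [s′_ν]·Σ'_{t′} [t′_μ]·S♮_0 μ t′ s s′ (inl b)(inl ν) + Σ'_{s′} [s′_μ]·Σ'_{t′} [t′_ν]·S♮_0 ν t′ s s′ (inl b)(inl μ) = 0`. -/
theorem tsum_faceface_S0_add_swap (ρ : Fin (d + 1) → ℤ) (sf sm cE cVH cΛ : ℝ) (μ ν b : Fin (d + 1)) (s : Site (d + 1)) :
    (∑' s' : Site (d + 1), (if s' ν % (Lc : ℤ) = (Lc : ℤ) - 1 then
        ∑' t' : Site (d + 1), (if t' μ % (Lc : ℤ) = (Lc : ℤ) - 1 then unitS sf sm (SpureRecAt d Lc ρ cE cVH cΛ 0) μ t' s s' (Sum.inl b) (Sum.inl ν) else 0) else 0)) +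
      ∑' s' : Site (d + 1), (if s' μ % (Lc : ℤ) = (Lc : ℤ) - 1 then
        ∑' t' : Site (d + 1), (if t' ν % (Lc : ℤ) = (Lc : ℤ) - 1 then unitS sf sm (SpureRecAt d Lc ρ cE cVH cΛ 0) ν t' s s' (Sum.inl b) (Sum.inl μ) else 0) else 0) = 0 := by
  have e : ∀ (κ τ : Fin (d + 1)) (s' : Site (d + 1)),
      (if s' τ % (Lc : ℤ) = (Lc : ℤ) - 1 then
        ∑' t' : Site (d + 1), (if t' κ % (Lc : ℤ) = (Lc : ℤ) - 1 then unitS sf sm (SpureRecAt d Lc ρ cE cVH cΛ 0) κ t' s s' (Sum.inl b) (Sum.inl τ) else 0) else 0) =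
      ((sf * sm)⁻¹ * (sf⁻¹ * sf⁻¹) * cE) * (if s' τ % (Lc : ℤ) = (Lc : ℤ) - 1 then
        ∑' t' : Site (d + 1), (if t' κ % (Lc : ℤ) = (Lc : ℤ) - 1 then wilsonA d κ t' s s' (Sum.inl b) (Sum.inl τ) else 0) else 0) := by
    intro κ τ s'
    split_ifs with h
    · rw [← tsum_mul_left]
      refine tsum_congr fun t' => ?_
      split_ifs
      · rw [SpureRecAt_zero_unitS_inl_inl]
      · rw [mul_zero]
    · rw [mul_zero]
  simp_rw [e]
  rw [tsum_mul_left, tsum_mul_left, ← mul_add, tsum_ite_ite_wilsonA_eq_pair, tsum_ite_ite_wilsonA_eq_pair,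
    tsum_pair_faceface_wilsonA_add_swap μ ν (fun n => if n % (Lc : ℤ) = (Lc : ℤ) - 1 then (1 : ℝ) else 0)
      (fun n => if n % (Lc : ℤ) = (Lc : ℤ) - 1 then (1 : ℝ) else 0) b s, mul_zero]

end LevelZero

/-! ## §4 The nested face source of a block-covariant family is block-periodic in its free leg -/

section Periodic

variable {N : ℕ}

/-- [folklore] **BLOCK PERIODICITY OF THE NESTED FACE SOURCE** (any block-covariant `S`, every leg `f`, every direction pair):
`Σ'_{s′}[s′_ν]·Σ'_{t′}[t′_μ]·S μ t′ (s + N•v) s′ f (inl ν) = Σ'_{s′}[s′_ν]·Σ'_{t′}[t′_μ]·S μ t′ s s′ f (inl ν)` (reindex both sums by `+ N•v`). -/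
theorem tsum_faceface_block_periodic {S : Fin (d + 1) → Site (d + 1) → MKer (d + 1) (Fib d)}
    (hScov : ∀ (κ : Fin (d + 1)) (u t : Site (d + 1)), S κ (u + (N : ℤ) • t) = shiftK (-((N : ℤ) • t)) (S κ u))
    (μ ν : Fin (d + 1)) (s v : Site (d + 1)) (f g : Fib d) :
    (∑' s' : Site (d + 1), (if s' ν % (N : ℤ) = (N : ℤ) - 1 then
        ∑' t' : Site (d + 1), (if t' μ % (N : ℤ) = (N : ℤ) - 1 then S μ t' (s + (N : ℤ) • v) s' f g else 0) else 0)) =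
      ∑' s' : Site (d + 1), (if s' ν % (N : ℤ) = (N : ℤ) - 1 then
        ∑' t' : Site (d + 1), (if t' μ % (N : ℤ) = (N : ℤ) - 1 then S μ t' s s' f g else 0) else 0) := by
  have emod : ∀ (x : Site (d + 1)) (κ : Fin (d + 1)), (x + (N : ℤ) • v) κ % (N : ℤ) = x κ % (N : ℤ) := fun x κ => by
    simp only [Pi.add_apply, Pi.smul_apply, smul_eq_mul, Int.add_mul_emod_self_left]
  have hcov : ∀ t' s' : Site (d + 1), S μ (t' + (N : ℤ) • v) (s + (N : ℤ) • v) (s' + (N : ℤ) • v) f g = S μ t' s s' f g := by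
    intro t' s'
    rw [hScov μ t' v]
    simp only [shiftK, add_neg_cancel_right]
  calc (∑' s' : Site (d + 1), (if s' ν % (N : ℤ) = (N : ℤ) - 1 then
        ∑' t' : Site (d + 1), (if t' μ % (N : ℤ) = (N : ℤ) - 1 then S μ t' (s + (N : ℤ) • v) s' f g else 0) else 0))
      = ∑' s' : Site (d + 1), (if (s' + (N : ℤ) • v) ν % (N : ℤ) = (N : ℤ) - 1 then
        ∑' t' : Site (d + 1), (if t' μ % (N : ℤ) = (N : ℤ) - 1 then S μ t' (s + (N : ℤ) • v) (s' + (N : ℤ) • v) f g else 0) else 0) :=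
        ((Equiv.addRight ((N : ℤ) • v)).tsum_eq (fun s' : Site (d + 1) => if s' ν % (N : ℤ) = (N : ℤ) - 1 then
          ∑' t' : Site (d + 1), (if t' μ % (N : ℤ) = (N : ℤ) - 1 then S μ t' (s + (N : ℤ) • v) s' f g else 0) else 0)).symm
    _ = _ := by
        refine tsum_congr fun s' => ?_
        rw [emod]
        split_ifs with hs'
        · rw [← (Equiv.addRight ((N : ℤ) • v)).tsum_eq (fun t' : Site (d + 1) =>
            if t' μ % (N : ℤ) = (N : ℤ) - 1 then S μ t' (s + (N : ℤ) • v) (s' + (N : ℤ) • v) f g else 0)]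
          refine tsum_congr fun t' => ?_
          simp only [Equiv.coe_addRight, emod, hcov]
        · rfl

end Periodic

end Summit.QuantumFields.BalabanUV.Beta.GAN24.RespGaugeStencil

end
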